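import Literature.MathematicalPhysics.QuantumFieldTheory.Balaban1983to89.B9Eq3104CommutatorGradFormCurl
import Literature.MathematicalPhysics.QuantumFieldTheory.Balaban1983to89.B9Eq3104CommutatorSizesDD
import Literature.MathematicalPhysics.QuantumFieldTheory.Balaban1983to89.B13OpsYPencilHessian

/-!
# `Balaban1983to89.B9Eq3104CommutatorSizesCurv` — T. Bałaban, *Propagators for lattice gauge theories in a background field*,
# Commun. Math. Phys. **99** (1985) 389–434 [Balaban1985BackgroundPropagators], (3.10) p. 392 (the `Im U(∂p)`-term `Δ′` of the Hessian) and p. 409 ∕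
# p. 414 («K(h_□) … satisfies the inequality (3.89)»): THE PRINT-SHAPE SIZE OF THE CURVATURE PIECE `[h_□, Δ′₂(U)]` OF `K(h_□)(U) = [h_□, Δ_loc(U)]` AT THE
# COVER OF RECORD — a ZEROTH-order local operator with the small coefficient `c_f²·Im U(∂p)`, so its cut-off commutator is (∂h)·(c_f²Im U(∂p))·(values)
# (module M5.7-est, file D′₃b; with D′₁ (`DD*`), D′₂ (`D*𝒦D`), D′₃a (`Q*aQ`) every piece of this seat's `deltaLocY` is sized)

statement-level skeleton of published theorems with citation tags; proofs where landed; nothing here is a claim about the Yang–Mills mass gap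

## WHAT THIS FILE PROVES (THEOREMS only; 0 definitions, 0 `def … : Prop`, 0 sorry)
* `curv2Y_apply` (def-Y's `Δ′₂(U)` unfolded at a bond), `primeEdgeY_cutMulY` (the primed contour variable of `h•A` is `h(b_l₋)•A′(b_l)`), `norm_R_edgeParY_le`, `norm_primeEdgeY_le` (with r06∕p33's `norm_sgnY`, `norm_commY_le` reused BY NAME), `abs_hBdY_edge_sub_le` (two contour bonds of one plaquette: `|h_□(b_m₋) − h_□(b_l₋)| ≤ 2θ₁`),
  `sum_edge_indicator_le` (`#{(p, m) : b_m(p) = b} ≤ 4(d+1)`, by this seat's collapsed plaquette sums).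
* ★★ `norm_cutCommR_curv2Y_hTY_apply_le` — for bi-contractive `U`, the DISPLAYED smallness `‖c_f²·Im U(∂p)‖ ≤ δ_I` (zero at `U = 1`; on the class (3.35)
  `O(α₀M·L^{−2j})`, supplied by its owner) and a local bound `G₀` on `A` over the plaquettes through `b`:
  `‖([h_□]Δ′₂(U))A(b)‖ ≤ 64(d+1)·δ_I·θ₁·G₀`, `θ₁ = C1F∕(8S_j∕5)`.
HONEST SCOPE.  Constants crude (`64(d+1)`), not print's; nothing of Thm 3.10 ∕ 3.3 asserted; YM mass gap NOT proved by any of this (Track A conditional rung).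
`--supports stmt-QuantumFields-19200`.  Net new unproved facts: 0.
-/

noncomputable section

namespace Literature.MathematicalPhysics.QuantumFieldTheory.Balaban1983to89.B9Eq3104CommutatorSizesCurv

open Node00
open B9Thm37CubeCoverCommutators (cutMulY cutMulY_apply hTY hTY_apply)
open B9Thm37CubeCoverCommutatorSizes (abs_hTY_shiftY_sub_le)
open B9Eq3104CutoffCommutators (cutCommR cutCommR_apply hBdY hBdY_apply)
open B9Eq3104CommutatorGradFormCurl (sum_plaqY_ite_src_mu sum_plaqY_ite_src_nu sum_plaqY_ite_shift_mu sum_plaqY_ite_shift_nu)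
open B6KLevelCensusIndexV1 (KIdx)
open B6GlobalChartV1 (PV)
open B6MultiLevelBoxOperator (bigSide)
open B6Cover236MultiLevelBlocks (cubes)
open B6Partition118KLevelFineSizes (C1F C1F_nonneg)
open Node00.OpsYNablaBridge (chartY shiftY_chartY)
open B9Eq39Adjoint (R R_smul R_sub R_zero)
open B9Eq310Hermitian (norm_R_le)
open B9Ineq369CurvatureSmallAtLettersY (norm_sgnY)
open B13OpsYPencilHessian (norm_commY_le)
open scoped Matrix

variable {𝔸 : Type} [NormedRing 𝔸] [NormedAlgebra ℂ 𝔸] [CompleteSpace 𝔸]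
variable {d ℓ : ℕ} {hd : 1 ≤ d + 1} {hL : Odd (ℓ + 1) ∧ 1 < ℓ + 1} {b₀ b₁ : ℝ}
variable (i : KIdx d ℓ hd hL b₀ b₁)

/-! ## §1 `Δ′₂(U)` unfolded, and the sizes of its letters -/

/-- def-Y's `Δ′₂(U)` at a bond. [cite: Balaban1985BackgroundPropagators, (3.10) p.392, dictionary] -/
theorem curv2Y_apply (U : CfgY 𝔸 i) (X : FBondY i → 𝔸) (b : FBondY i) :
    curv2Y i U X b = (1 / 2 : ℂ) • ∑ p : PlaqY i, ∑ m : Fin 4,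
      (if edgeY i p m = b then
        sgnY m • R (edgeParY i U p m)⁻¹ (commY (((i.cf ^ 2 : ℝ) : ℂ) • imHolY i U p)
          ((∑ l : Fin 4, (if m < l then primeEdgeY i U p l else 0)) X - (∑ l : Fin 4, (if l < m then primeEdgeY i U p l else 0)) X))
      else 0) := by
  classical
  simp only [curv2Y, LinearMap.smul_apply, Pi.smul_apply, LinearMap.pi_apply, LinearMap.coe_sum, Finset.sum_apply]
  congr 1
  refine Finset.sum_congr rfl fun p _ => Finset.sum_congr rfl fun m _ => ?_
  split_ifs with h
  · simp only [LinearMap.smul_apply, LinearMap.comp_apply, LinearMap.sub_apply]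
    rfl
  · rfl

/-- the primed contour variable of `h•A`: `(h•A)′(b_l) = h(b_l₋)•A′(b_l)`. [cite: Balaban1985BackgroundPropagators, (3.2) p.390, bookkeeping] -/
theorem primeEdgeY_cutMulY (U : CfgY 𝔸 i) (p : PlaqY i) (l : Fin 4) (h : SiteY i → ℝ) (A : FBondY i → 𝔸) :
    primeEdgeY i U p l (cutMulY (hBdY i h) A) = ((h (chartY i (edgeY i p l).src) : ℝ) : ℂ) • primeEdgeY i U p l A := by
  simp only [primeEdgeY, LinearMap.smul_apply, LinearMap.comp_apply, LinearMap.proj_apply, cutMulY_apply, hBdY_apply]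
  show sgnY l • R (edgeParY i U p l) (((h (chartY i (edgeY i p l).src) : ℝ) : ℂ) • A (edgeY i p l)) = _
  rw [R_smul, smul_comm]
  rfl

/-- the contour transporters act as contractions (by conjugation) when `U` is a bi-contraction (`V_m ∈ {U(x,w), 1, 1, U(x,y)}`).
[cite: Balaban1985BackgroundPropagators, (3.2) p.390, bookkeeping] -/
theorem norm_R_edgeParY_le (U : CfgY 𝔸 i) (hU : ∀ μ x, ‖(U μ x : 𝔸)‖ ≤ 1 ∧ ‖(((U μ x)⁻¹ : 𝔸ˣ) : 𝔸)‖ ≤ 1) (p : PlaqY i) (l : Fin 4) (X : 𝔸) :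
    ‖R (edgeParY i U p l) X‖ ≤ ‖X‖ ∧ ‖R (edgeParY i U p l)⁻¹ X‖ ≤ ‖X‖ := by
  have hgen : ∀ V : 𝔸ˣ, (‖(V : 𝔸)‖ ≤ 1 ∧ ‖((V⁻¹ : 𝔸ˣ) : 𝔸)‖ ≤ 1) → ‖R V X‖ ≤ ‖X‖ ∧ ‖R V⁻¹ X‖ ≤ ‖X‖ :=
    fun V hV => ⟨norm_R_le hV.1 hV.2 X, norm_R_le hV.2 (by rw [inv_inv]; exact hV.1) X⟩
  have hone : ‖R (1 : 𝔸ˣ) X‖ ≤ ‖X‖ ∧ ‖R (1 : 𝔸ˣ)⁻¹ X‖ ≤ ‖X‖ := by rw [inv_one, B9Eq39Adjoint.R_one]; exact ⟨le_rfl, le_rfl⟩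
  fin_cases l
  · exact hgen _ (hU _ _)
  · exact hone
  · exact hone
  · exact hgen _ (hU _ _)

/-- `‖A′(b_l)‖ ≤ ‖A(b_l)‖` for bi-contractive transporters. [cite: Balaban1985BackgroundPropagators, (3.2) p.390] -/
theorem norm_primeEdgeY_le (U : CfgY 𝔸 i) (hU : ∀ μ x, ‖(U μ x : 𝔸)‖ ≤ 1 ∧ ‖(((U μ x)⁻¹ : 𝔸ˣ) : 𝔸)‖ ≤ 1)
    (p : PlaqY i) (l : Fin 4) (A : FBondY i → 𝔸) : ‖primeEdgeY i U p l A‖ ≤ ‖A (edgeY i p l)‖ := by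
  simp only [primeEdgeY, LinearMap.smul_apply, LinearMap.comp_apply, LinearMap.proj_apply]
  show ‖sgnY l • R (edgeParY i U p l) (A (edgeY i p l))‖ ≤ _
  rw [norm_smul, norm_sgnY, one_mul]
  exact (norm_R_edgeParY_le i U hU p l _).1

omit [NormedAlgebra ℂ 𝔸] [CompleteSpace 𝔸] in
/-- two contour bonds of one plaquette have initial points at most two lattice steps apart: `|h_□(b_m₋) − h_□(b_l₋)| ≤ 2θ₁`.
[cite: Balaban1985BackgroundPropagators, (3.2) p.390; Balaban1984PropagatorsII, p.247] -/
theorem abs_hBdY_edge_sub_le (c : ↥(cubes i.D.toDomains)) (p : PlaqY i) (m l : Fin 4) :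
    |hBdY i (hTY i c) (edgeY i p m) - hBdY i (hTY i c) (edgeY i p l)| ≤ 2 * (C1F d ℓ / (8 / 5 * (bigSide ℓ i.Mh c.1.1 : ℝ))) := by
  have one : ∀ k : Fin 4, |hBdY i (hTY i c) (edgeY i p k) - hTY i c (chartY i p.src)| ≤ C1F d ℓ / (8 / 5 * (bigSide ℓ i.Mh c.1.1 : ℝ)) := by
    intro k
    have hθ : 0 ≤ C1F d ℓ / (8 / 5 * (bigSide ℓ i.Mh c.1.1 : ℝ)) := div_nonneg (C1F_nonneg d ℓ) (by positivity)
    fin_cases k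
    · show |hTY i c (chartY i (p.src.shift p.ν)) - hTY i c (chartY i p.src)| ≤ _
      rw [← shiftY_chartY]; exact abs_hTY_shiftY_sub_le i c p.ν _
    · show |hTY i c (chartY i p.src) - hTY i c (chartY i p.src)| ≤ _
      rw [sub_self, abs_zero]; exact hθ
    · show |hTY i c (chartY i p.src) - hTY i c (chartY i p.src)| ≤ _
      rw [sub_self, abs_zero]; exact hθ
    · show |hTY i c (chartY i (p.src.shift p.μ)) - hTY i c (chartY i p.src)| ≤ _
      rw [← shiftY_chartY]; exact abs_hTY_shiftY_sub_le i c p.μ _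
  calc |hBdY i (hTY i c) (edgeY i p m) - hBdY i (hTY i c) (edgeY i p l)|
      = |(hBdY i (hTY i c) (edgeY i p m) - hTY i c (chartY i p.src)) - (hBdY i (hTY i c) (edgeY i p l) - hTY i c (chartY i p.src))| := by ring_nf
    _ ≤ |hBdY i (hTY i c) (edgeY i p m) - hTY i c (chartY i p.src)| + |hBdY i (hTY i c) (edgeY i p l) - hTY i c (chartY i p.src)| := abs_sub _ _
    _ ≤ _ := by linarith [one m, one l]

omit [NormedAlgebra ℂ 𝔸] [CompleteSpace 𝔸] in
/-- **the number of (plaquette, contour position) pairs through a bond**: `Σ_p Σ_m [b_m(p) = b] ≤ 4(d+1)` (by the four collapsed plaquette sums).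
[cite: Balaban1985BackgroundPropagators, (3.2) p.390, (3.9) p.392, bookkeeping] -/
theorem sum_edge_indicator_le (b : FBondY i) :
    (∑ p : PlaqY i, ∑ m : Fin 4, if edgeY i p m = b then (1 : ℝ) else 0) ≤ 4 * ((d : ℝ) + 1) := by
  classical
  have hcnt : ∀ (P : Fin (d + 1) → Prop) [DecidablePred P], (∑ c : Fin (d + 1), if h : P c then (1 : ℝ) else 0) ≤ (d : ℝ) + 1 := by
    intro P _
    calc (∑ c : Fin (d + 1), if h : P c then (1 : ℝ) else 0) ≤ ∑ c : Fin (d + 1), (1 : ℝ) :=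
          Finset.sum_le_sum fun c _ => by split_ifs <;> norm_num
      _ = (d : ℝ) + 1 := by simp
  have e : ∀ p : PlaqY i, (∑ m : Fin 4, if edgeY i p m = b then (1 : ℝ) else 0)
      = (if (⟨p.src.shift p.ν, p.μ⟩ : FBondY i) = b then (1 : ℝ) else 0) + (if (⟨p.src, p.ν⟩ : FBondY i) = b then (1 : ℝ) else 0)
        + (if (⟨p.src, p.μ⟩ : FBondY i) = b then (1 : ℝ) else 0) + (if (⟨p.src.shift p.μ, p.ν⟩ : FBondY i) = b then (1 : ℝ) else 0) := by
    intro p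
    rw [Fin.sum_univ_four]
    rfl
  simp_rw [e]
  rw [Finset.sum_add_distrib, Finset.sum_add_distrib, Finset.sum_add_distrib, sum_plaqY_ite_shift_nu, sum_plaqY_ite_src_nu, sum_plaqY_ite_src_mu,
    sum_plaqY_ite_shift_mu]
  have h1 := hcnt (fun c => b.dir < c)
  have h2 := hcnt (fun a => a < b.dir)
  linarith [h1, h2]

/-! ## §2 The curvature piece of `K(h_□)(U)` in print's shape -/

/-- ★★ **THE CURVATURE PIECE `[h_□, Δ′₂(U)]` OF `K(h_□)(U)` IN PRINT'S SHAPE — (3.10) p. 392 ∕ p. 409.**  For bi-contractive `U`, the displayed smallness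
`‖c_f²·Im U(∂p)‖ ≤ δ_I` of the plaquette fields, and a local bound `G₀ ≥ ‖A(b_l(p))‖` over the contour bonds of the plaquettes through `b`:
`‖([h_□]Δ′₂(U))A(b)‖ ≤ 64(d+1)·δ_I·θ₁·G₀`, `θ₁ = C1F∕(8S_j∕5)` — each of the `≤ 4(d+1)` contour positions through `b` contributes
`½·‖σ_m R(V_m)⁻¹ i[Σ_l (h_□(b₋) − h_□(b_l₋))A′(b_l), c_f²Im U(∂p)]‖ ≤ ½·2δ_I·2·4·2θ₁·G₀`. [cite: Balaban1985BackgroundPropagators, (3.10) p.392, (3.89) p.409, p.414 l.1–3, (3.35) p.396] -/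
theorem norm_cutCommR_curv2Y_hTY_apply_le (c : ↥(cubes i.D.toDomains)) (U : CfgY 𝔸 i)
    (hU : ∀ μ x, ‖(U μ x : 𝔸)‖ ≤ 1 ∧ ‖(((U μ x)⁻¹ : 𝔸ˣ) : 𝔸)‖ ≤ 1) {δI : ℝ} (hδI : 0 ≤ δI)
    (hI : ∀ p : PlaqY i, ‖((i.cf ^ 2 : ℝ) : ℂ) • imHolY i U p‖ ≤ δI)
    (A : FBondY i → 𝔸) (b : FBondY i) {G₀ : ℝ} (hG₀ : 0 ≤ G₀) (hA : ∀ (p : PlaqY i) (m l : Fin 4), edgeY i p m = b → ‖A (edgeY i p l)‖ ≤ G₀) :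
    ‖cutCommR (hBdY i (hTY i c)) (hBdY i (hTY i c)) (curv2Y i U) A b‖
      ≤ 64 * ((d : ℝ) + 1) * δI * (C1F d ℓ / (8 / 5 * (bigSide ℓ i.Mh c.1.1 : ℝ))) * G₀ := by
  classical
  have hθ : 0 ≤ C1F d ℓ / (8 / 5 * (bigSide ℓ i.Mh c.1.1 : ℝ)) := div_nonneg (C1F_nonneg d ℓ) (by positivity)
  set θ₁ := C1F d ℓ / (8 / 5 * (bigSide ℓ i.Mh c.1.1 : ℝ)) with hθ₁
  set h := hTY i c with hh
  -- the pieces of `Δ′₂` with the profile outside and inside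
  set S : PlaqY i → Fin 4 → (FBondY i → 𝔸) → 𝔸 := fun p m X =>
    (∑ l : Fin 4, (if m < l then primeEdgeY i U p l else 0)) X - (∑ l : Fin 4, (if l < m then primeEdgeY i U p l else 0)) X with hS
  set T : PlaqY i → Fin 4 → (FBondY i → 𝔸) → 𝔸 := fun p m X =>
    if edgeY i p m = b then sgnY m • R (edgeParY i U p m)⁻¹ (commY (((i.cf ^ 2 : ℝ) : ℂ) • imHolY i U p) (S p m X)) else 0 with hT
  have happ : ∀ X, curv2Y i U X b = (1 / 2 : ℂ) • ∑ p : PlaqY i, ∑ m : Fin 4, T p m X := fun X => curv2Y_apply i U X b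
  -- the commutator inside `S`: `h(b₋)•S(A) − S(h•A) = Σ_l ±[..](h(b₋) − h(b_l₋))•A′(b_l)`
  have hSsize : ∀ (p : PlaqY i) (m : Fin 4), edgeY i p m = b →
      ‖((h (chartY i b.src) : ℝ) : ℂ) • S p m A - S p m (cutMulY (hBdY i h) A)‖ ≤ 2 * (4 * (2 * θ₁ * G₀)) := by
    intro p m hpm
    have hl : ∀ l : Fin 4, ‖((h (chartY i b.src) : ℝ) : ℂ) • primeEdgeY i U p l A - primeEdgeY i U p l (cutMulY (hBdY i h) A)‖ ≤ 2 * θ₁ * G₀ := by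
      intro l
      rw [primeEdgeY_cutMulY, ← sub_smul, ← Complex.ofReal_sub, norm_smul, Complex.norm_real, Real.norm_eq_abs]
      have e1 : |h (chartY i b.src) - h (chartY i (edgeY i p l).src)| ≤ 2 * θ₁ := by
        have := abs_hBdY_edge_sub_le i c p m l
        rwa [hpm, hBdY_apply, hBdY_apply] at this
      exact mul_le_mul e1 ((norm_primeEdgeY_le i U hU p l A).trans (hA p m l hpm)) (norm_nonneg _) (by positivity)
    have hsum : ∀ (P : Fin 4 → Prop) [DecidablePred P],
        ‖((h (chartY i b.src) : ℝ) : ℂ) • (∑ l : Fin 4, (if P l then primeEdgeY i U p l else 0)) A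
            - (∑ l : Fin 4, (if P l then primeEdgeY i U p l else 0)) (cutMulY (hBdY i h) A)‖ ≤ 4 * (2 * θ₁ * G₀) := by
      intro P _
      rw [LinearMap.coe_sum, Finset.sum_apply, Finset.sum_apply, Finset.smul_sum, ← Finset.sum_sub_distrib]
      calc ‖∑ l : Fin 4, (((h (chartY i b.src) : ℝ) : ℂ) • (if P l then primeEdgeY i U p l else 0) A
              - (if P l then primeEdgeY i U p l else 0) (cutMulY (hBdY i h) A))‖
          ≤ ∑ l : Fin 4, (2 * θ₁ * G₀) := by
            refine (norm_sum_le _ _).trans (Finset.sum_le_sum fun l _ => ?_)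
            split_ifs with hP
            · exact hl l
            · rw [LinearMap.zero_apply, LinearMap.zero_apply, smul_zero, sub_zero, norm_zero]; positivity
        _ = 4 * (2 * θ₁ * G₀) := by simp
    have e : ((h (chartY i b.src) : ℝ) : ℂ) • S p m A - S p m (cutMulY (hBdY i h) A)
        = (((h (chartY i b.src) : ℝ) : ℂ) • (∑ l : Fin 4, (if m < l then primeEdgeY i U p l else 0)) A
            - (∑ l : Fin 4, (if m < l then primeEdgeY i U p l else 0)) (cutMulY (hBdY i h) A))
          - (((h (chartY i b.src) : ℝ) : ℂ) • (∑ l : Fin 4, (if l < m then primeEdgeY i U p l else 0)) A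
            - (∑ l : Fin 4, (if l < m then primeEdgeY i U p l else 0)) (cutMulY (hBdY i h) A)) := by
      simp only [hS, smul_sub]; abel
    rw [e]
    exact (norm_sub_le _ _).trans (by linarith [hsum (fun l => m < l), hsum (fun l => l < m)])
  -- per (p, m): the commutator of `T`
  have hTsize : ∀ (p : PlaqY i) (m : Fin 4),
      ‖((h (chartY i b.src) : ℝ) : ℂ) • T p m A - T p m (cutMulY (hBdY i h) A)‖
        ≤ if edgeY i p m = b then 2 * δI * (2 * (4 * (2 * θ₁ * G₀))) else 0 := by
    intro p m
    by_cases hpm : edgeY i p m = b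
    · simp only [hT, if_pos hpm]
      rw [smul_comm, ← smul_sub, ← R_smul, ← R_sub, ← LinearMap.map_smul_of_tower, ← map_sub, norm_smul, norm_sgnY, one_mul]
      refine (norm_R_edgeParY_le i U hU p m _).2.trans ((norm_commY_le _ _).trans ?_)
      exact mul_le_mul (mul_le_mul_of_nonneg_left (hI p) (by norm_num)) (hSsize p m hpm) (norm_nonneg _) (by positivity)
    · simp only [hT, if_neg hpm, smul_zero, sub_zero, norm_zero, le_refl]
  -- assemble
  rw [cutCommR_apply, happ, happ, hBdY_apply, smul_comm, ← smul_sub, norm_smul, Finset.smul_sum, ← Finset.sum_sub_distrib]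
  have hn : ‖(1 / 2 : ℂ)‖ = 1 / 2 := by norm_num
  rw [hn]
  have inner : ‖∑ p : PlaqY i, (((h (chartY i b.src) : ℝ) : ℂ) • ∑ m : Fin 4, T p m A - ∑ m : Fin 4, T p m (cutMulY (hBdY i h) A))‖
      ≤ ∑ p : PlaqY i, ∑ m : Fin 4, (if edgeY i p m = b then 2 * δI * (2 * (4 * (2 * θ₁ * G₀))) else 0) := by
    refine (norm_sum_le _ _).trans (Finset.sum_le_sum fun p _ => ?_)
    rw [Finset.smul_sum, ← Finset.sum_sub_distrib]
    exact (norm_sum_le _ _).trans (Finset.sum_le_sum fun m _ => hTsize p m)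
  have cnt := sum_edge_indicator_le i b
  have factor : (∑ p : PlaqY i, ∑ m : Fin 4, (if edgeY i p m = b then 2 * δI * (2 * (4 * (2 * θ₁ * G₀))) else 0))
      = (2 * δI * (2 * (4 * (2 * θ₁ * G₀)))) * ∑ p : PlaqY i, ∑ m : Fin 4, (if edgeY i p m = b then (1 : ℝ) else 0) := by
    rw [Finset.mul_sum]
    refine Finset.sum_congr rfl fun p _ => ?_
    rw [Finset.mul_sum]
    refine Finset.sum_congr rfl fun m _ => ?_
    split_ifs <;> simp
  rw [factor] at inner
  have hK : 0 ≤ 2 * δI * (2 * (4 * (2 * θ₁ * G₀))) := by positivity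
  calc 1 / 2 * ‖∑ p : PlaqY i, (((h (chartY i b.src) : ℝ) : ℂ) • ∑ m : Fin 4, T p m A - ∑ m : Fin 4, T p m (cutMulY (hBdY i h) A))‖
      ≤ 1 / 2 * ((2 * δI * (2 * (4 * (2 * θ₁ * G₀)))) * (4 * ((d : ℝ) + 1))) :=
        mul_le_mul_of_nonneg_left (inner.trans (mul_le_mul_of_nonneg_left cnt hK)) (by norm_num)
    _ = _ := by ring

end Literature.MathematicalPhysics.QuantumFieldTheory.Balaban1983to89.B9Eq3104CommutatorSizesCurv

end
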